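import Literature.AnabelianGeometry.EtaleTheta.Discharge.Sec5Prop53ChainModel
import Literature.AnabelianGeometry.EtaleTheta.FrobenioidThetaDivisorSupportR
import Literature.AlgebraicGeometry.Frobenioids.PiMonoprimePerfFactorial
import Literature.AlgebraicGeometry.Frobenioids.ArithmeticDivisorsPerfFactorial
import HarnessLib

/-!
# [EtTh] §5, Prop. 5.3 at the `ℤ`-CHAIN MODEL: `Φ(A_⊚) = ∏_{ℤ⊔ℤ} ℤ_{≥0}` (monoid type `ℤ`, INFINITELY supported
# log-divisors), base automorphisms translating the chain, and its `DivisorPrimeData` with `div(Θ̈) = Σ_j x_j`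

Mochizuki, *The étale theta function …*, Publ. RIMS **45** (2009), §5, Prop. 5.3, pp. 325–327 (PDF pp. 99–101)
[cite: MochizukiEtTh2009, Prop 5.3 p.325 (PDF p.99)]; Prop. 3.2 (i) p. 296 (PDF p. 70): `Div_+(Z^log_∞)^pf` "may be naturally
identified with a direct PRODUCT of copies of `ℚ_{≥0}`, indexed by the cusps … and irreducible components of the special
fiber"; Prop. 1.4 (i) (`div(Θ̈)`: order `1` at every cusp); Def. 3.6 (i) p. 302 (PDF p. 76) (`C` "of monoid type `ℤ`").
Cell abc-iut, layer L2, ROWS #15d R287 «PROP 5.3 (ii)/(iii) NON-VACUOUS WITNESSES» (abc-iut-L2-lead gen 4), seat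
abc-iut-w6-d061 (gen 4); NV census v4 row `DivisorSupportData'`.

WHY A NEW CARRIER.  abc-iut-L6-d1's `DivisorSupportData' 𝔓` (F2 product-valued factorization, gen_𝔭 generating
`Φ(A_⊚)_𝔭 ≅ ℤ_{≥0}`, F3 incidence, F5 `ord_𝔠 div(Θ̈) = 1` at EVERY cuspidal prime, F6 translations) is EMPTY at every §5
datum the cell has: (a) abc-iut-f-009 / f-128's `Φ(A_⊚) = ⊕_{ℤ⊔ℤ} ℚ_{≥0}` is PERFECT (`factor_carrier` fails, abc-iut-f-127
`isEmpty_divisorSupportData'_of_isPerfect`), and (b) it is a DIRECT SUM (F5 needs an infinitely supported `div(Θ̈)`).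
THIS FILE builds the `ℤ`-chain twin of abc-iut-f-128's `chainTheta` with **`Φ(A_⊚) := ∏_{ℤ⊔ℤ} ℤ_{≥0}`** (`Φz`: components
`inl n`, cusps `inr n`; a FULL product — abc-iut-w4-d084's `PiMonoprime` prime calculus needs monoprime factors only):
`reindexZ`, `chainPreZ` / `chainStubZ` / **`chainThetaZ : ThetaFrobenioid TZ TZ`** (same `C = D = SingleObj ℤ`, same
`ρ`, `Π^tp`, `K` as f-128; `Aut_C(A_⊚) ≅ ℤ` translates the chain, `pullAut_chainZ`), the prime dictionary (`idxZ`, `PZ`,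
`idxZ_congr_reindexZ`), and **`chainPrimeDataZ : DivisorPrimeData chainThetaZ`** (cusps = `inr`, `Prime^csp ↠ Prime^ncsp :
x_n ↦ C_n`, labels, **`div(Θ̈) := [𝟙_cusps]`** — order `1` at every cusp).  The sequel
`Sec5Prop53ChainModelZSupport.lean` inhabits `DivisorSupportData' chainPrimeDataZ`.
HONEST FRAMING: a MODEL datum over the cell's abstract §5 interface (no field of `ThetaFrobenioid` asserts a result); says nothing
about the tempered Frobenioid of [EtTh] §5 or about [IUTchIII] Cor. 3.12; no side taken; typed ≠ proved.
-/

noncomputable section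

namespace Literature.AnabelianGeometry.EtaleTheta.FrobenioidThetaDivisors.Prop53ChainZ

open CategoryTheory Literature.AlgebraicGeometry.Frobenioids ConstantMultiple ConstantMultiple.Cor512Toy Prop53Toy
  Prop53Chain

/-! ### `Φ(A_⊚) := ∏_{ℤ ⊔ ℤ} ℤ_{≥0}` and its re-indexings -/

/-- The `ℤ`-chain divisor monoid `Φ := ∏_{ℤ ⊔ ℤ} ℤ_{≥0}` (multiplicatively): INTEGER log-divisors on the chain, possibly
infinitely supported (Prop. 3.2 (i): a direct product over cusps ⊔ components; monoid type `ℤ`).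
[cite: MochizukiEtTh2009, Prop 3.2 (i) p.296 (PDF p.70)] -/
abbrev Φz : Type := Idx → Multiplicative ℕ

/-- Every factor `ℤ_{≥0}` is monoprime. [cite: MochizukiFrdI2008, §0 p.10] -/
theorem hPz : ∀ _ : Idx, IsMonoprime (Multiplicative ℕ) := fun _ => isMonoprime_multiplicative_nat

/-- Re-indexing `∏_{ℤ⊔ℤ} ℤ_{≥0}` along a permutation `σ` of the indices: `(reindexZ σ f)_j = f_{σ⁻¹ j}`.
[cite: MochizukiEtTh2009, Prop 5.3 p.325 (PDF p.99)] -/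
def reindexZ (σ : Idx ≃ Idx) : Φz ≃* Φz where
  toFun f j := f (σ.symm j)
  invFun f j := f (σ j)
  left_inv f := funext fun j => by simp
  right_inv f := funext fun j => by simp
  map_mul' _ _ := rfl

/-- `(reindexZ σ f) j = f (σ⁻¹ j)`. [cite: MochizukiEtTh2009, Prop 5.3 p.325 (PDF p.99)] -/
@[simp] theorem reindexZ_apply (σ : Idx ≃ Idx) (f : Φz) (j : Idx) : reindexZ σ f j = f (σ.symm j) := rfl

/-- Translating by `0` is the identity. [cite: MochizukiEtTh2009, Prop 5.3 p.325 (PDF p.99)] -/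
theorem reindexZ_shift_zero (f : Φz) : reindexZ (shift 0) f = f :=
  funext fun j => congrArg f (show (shift 0).symm j = j by rcases j with n | n <;> simp)

/-- Translating by `a + b` is translating by `a`, then by `b`. [cite: MochizukiEtTh2009, Prop 5.3 p.325 (PDF p.99)] -/
theorem reindexZ_shift_add (a b : ℤ) (f : Φz) : reindexZ (shift (a + b)) f = reindexZ (shift b) (reindexZ (shift a) f) :=
  funext fun j => congrArg f
    (show (shift (a + b)).symm j = (shift a).symm ((shift b).symm j) by rcases j with n | n <;> simp <;> ring)

/-- Re-indexing a single-index element: `reindexZ σ (x · e_i) = x · e_{σ i}`. [cite: MochizukiEtTh2009, Prop 5.3 p.325 (PDF p.99)] -/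
theorem reindexZ_mulSingle (σ : Idx ≃ Idx) (i : Idx) (x : Multiplicative ℕ) :
    reindexZ σ (Pi.mulSingle i x) = Pi.mulSingle (σ i) x := by
  funext j
  rw [reindexZ_apply]
  by_cases h : j = σ i
  · subst h
    rw [Equiv.symm_apply_apply, Pi.mulSingle_eq_same, Pi.mulSingle_eq_same]
  · rw [Pi.mulSingle_eq_of_ne h, Pi.mulSingle_eq_of_ne]
    intro h'
    exact h ((Equiv.symm_apply_eq σ).mp h')

/-! ### The `ℤ`-chain `ThetaFrobenioid` (f-128's `chainTheta` with `Φ(⋆) := ∏_{ℤ⊔ℤ} ℤ_{≥0}`) -/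

/-- The `ℤ`-chain pre-Frobenioid data: `Base = 𝟭`, `Φ(⋆) = ∏_{ℤ ⊔ ℤ} ℤ_{≥0}`, pull-back along `k : ⋆ → ⋆` = translation by `k`,
all divisors `0`, all Frobenius degrees `1`. [cite: MochizukiEtTh2009, Prop 5.3 p.325 (PDF p.99)] -/
def chainPreZ : PreFrobenioidData.{0} TZ TZ where
  base := 𝟭 TZ
  Mon := fun _ => Φz
  pull := fun k => (reindexZ (shift (Multiplicative.toAdd k))).toMonoidHom
  pull_id := fun _ x => reindexZ_shift_zero x
  pull_comp := fun β α x => reindexZ_shift_add (Multiplicative.toAdd α) (Multiplicative.toAdd β) x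
  div := fun _ => 1
  degFr := fun _ => 1
  div_id := fun _ => rfl
  div_comp := fun _ _ => by simp
  degFr_id := fun _ => rfl
  degFr_comp := fun _ _ => rfl

/-- The `ℤ`-chain `TemperedFrobenioidStub` (units trivial, as in f-128's `chainStub`). [cite: MochizukiEtTh2009, §5 p.322 (PDF p.96)] -/
def chainStubZ : FrobenioidTheta.TemperedFrobenioidStub.{0} TZ TZ where
  pre := chainPreZ
  units_comm S := ⟨⟨fun a b => Subtype.ext <| Aut.ext <| by
    change b.1.hom ≫ a.1.hom = a.1.hom ≫ b.1.hom
    rw [SingleObj.comp_as_mul, SingleObj.comp_as_mul]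
    exact @mul_comm (Multiplicative ℤ) _ a.1.hom b.1.hom⟩⟩
  biratUnits := fun _ => Unit
  unitsToBirat := fun _ => 1
  unitsToBirat_injective S := by
    intro a b _
    apply Subtype.ext
    apply Aut.ext
    exact a.2.1.trans b.2.1.symm
  unitsPull := fun _ => 1
  IsBaseFrobeniusType := ⊤

/-- **The `ℤ`-chain model `chainThetaZ : ThetaFrobenioid (SingleObj ℤ) (SingleObj ℤ)`** — f-128's `chainTheta` verbatim except
`Φ(⋆) := ∏_{ℤ⊔ℤ} ℤ_{≥0}`: `A_⊚ = A_N = B_N = ⋆`, `s^⊓_N = s^⊔_N = 𝟙`, `N = 2`, `l = 1`, `Π^tp_X = ℤ × ℤ/2` ONTO `Aut(⋆) ≅ ℤ`,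
`Π^tp_Ÿ = 1`, `K = 𝔽₂`; `Aut_C(A_⊚) ≅ ℤ` translates the chain. [cite: MochizukiEtTh2009, Prop 5.3 p.325 (PDF p.99)] -/
def chainThetaZ : ThetaFrobenioid.{0} TZ TZ where
  toTemperedFrobenioidStub := chainStubZ
  lDelta := fun _ => Unit
  lDeltaMap := fun _ => MonoidHom.id Unit
  l := 1
  odd_l := odd_one
  N := 2
  Acirc := pt
  AN := pt
  BN := pt
  sCap := 𝟙 pt
  sCup := 𝟙 pt
  base_map_sCap := rfl
  isPreStep_sCap := ⟨rfl, by change IsIso (𝟙 _); infer_instance⟩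
  isPreStep_sCup := ⟨rfl, by change IsIso (𝟙 _); infer_instance⟩
  PiX := Multiplicative ℤ × Mm
  zquot := MonoidHom.fst _ _
  zquot_surjective := fun z => ⟨(z, 1), rfl⟩
  PiYdd := ⊥
  PiYdd_le := bot_le
  relindex_PiYdd := by rw [Subgroup.relIndex_bot_left, Nat.card_congr kerFstEquiv, Nat.card_zmod]
  PiYdd_normal := inferInstance
  isOpen_PiYdd := isOpen_discrete _
  ρ := rhoChain
  ρ_surjective := rhoChain_surjective
  isOpen_ker_ρ := isOpen_discrete _
  strv := 1
  sgpCap := 1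
  sgpCup := 1
  K := ZMod 2
  constEmb := 1
  constEmb_injective := by
    intro a b _
    have h : ∀ u : (ZMod 2)ˣ, u = 1 := by decide
    rw [h a, h b]
  thetaFn := ()

/-- `Φ(A_⊚)` of the `ℤ`-chain model is `∏_{ℤ⊔ℤ} ℤ_{≥0}`. [cite: MochizukiEtTh2009, Prop 5.3 p.325 (PDF p.99)] -/
theorem phiAcirc_eq : chainThetaZ.PhiAcirc = Φz := rfl

/-- **`Aut_C(A_⊚)` acts on `Φ(A_⊚)` by translating the chain**: `g` pulls back along `g⁻¹ ∈ ℤ`. [cite: MochizukiEtTh2009, Prop 5.3 (vi) p.326 (PDF p.100)] -/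
theorem pullAut_chainZ (g : Aut chainThetaZ.Acirc) (a : Φz) :
    chainThetaZ.pullAut g a = reindexZ (shift (Multiplicative.toAdd g.inv)) a := rfl

/-! ### Primes of `∏_{ℤ⊔ℤ} ℤ_{≥0}`: `Prime(Φ) ≃ ℤ ⊔ ℤ` (abc-iut-w4-d084's `PiMonoprime`) -/

/-- The index of a prime. [cite: MochizukiFrdI2008, §0 p.12] -/
def idxZ (𝔭 : Primes Φz) : Idx := PiMonoprime.idx hPz 𝔭

/-- The prime of an index (class of `e_i`). [cite: MochizukiFrdI2008, §0 p.12] -/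
def PZ (i : Idx) : Primes Φz := PiMonoprime.primeOf hPz i

/-- `idxZ (PZ i) = i`. [cite: MochizukiFrdI2008, §0 p.12] -/
@[simp] theorem idxZ_PZ (i : Idx) : idxZ (PZ i) = i := PiMonoprime.idx_primeOf hPz i

/-- `PZ (idxZ 𝔭) = 𝔭`. [cite: MochizukiFrdI2008, §0 p.12] -/
@[simp] theorem PZ_idxZ (𝔭 : Primes Φz) : PZ (idxZ 𝔭) = 𝔭 := PiMonoprime.primeOf_idx hPz 𝔭

/-- `idxZ` is injective. [cite: MochizukiFrdI2008, §0 p.12] -/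
theorem idxZ_injective : Function.Injective idxZ := fun 𝔭 𝔮 h => by rw [← PZ_idxZ 𝔭, ← PZ_idxZ 𝔮, h]

/-- The subset of a prime: the elements supported exactly at its index. [cite: MochizukiFrdI2008, §0 p.12] -/
theorem mem_carrier_iff (𝔭 : Primes Φz) (a : Φz) : a ∈ 𝔭.carrier ↔ dsupp a = {idxZ 𝔭} :=
  PiMonoprime.mem_carrier_iff hPz 𝔭 a

/-- `e_i ∈` the subset of `PZ i`. [cite: MochizukiFrdI2008, §0 p.12] -/
theorem mulSingle_mem_carrier (i : Idx) {x : Multiplicative ℕ} (hx : x ≠ 1) : Pi.mulSingle i x ∈ (PZ i).carrier := by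
  rw [mem_carrier_iff, idxZ_PZ]
  exact PiMonoprime.dsupp_mulSingle hx

/-- **Transport of primes along a re-indexing**: `idx(σ_* 𝔭) = σ (idx 𝔭)`. [cite: MochizukiFrdI2008, §0 p.12] -/
theorem idxZ_congr_reindexZ (σ : Idx ≃ Idx) (𝔭 : Primes Φz) : idxZ (Primes.congr (reindexZ σ) 𝔭) = σ (idxZ 𝔭) := by
  obtain ⟨a, ha⟩ := exists_mem_carrier 𝔭
  have ha' : reindexZ σ a ∈ (Primes.congr (reindexZ σ) 𝔭).carrier := by
    obtain ⟨h, rfl⟩ := ha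
    exact ⟨h.map_mulEquiv _, (Primes.congr_mk _ a h _).symm⟩
  rw [mem_carrier_iff] at ha ha'
  have hmem : σ (idxZ 𝔭) ∈ dsupp (reindexZ σ a) := by
    show reindexZ σ a (σ (idxZ 𝔭)) ≠ 1
    rw [reindexZ_apply, Equiv.symm_apply_apply]
    have : idxZ 𝔭 ∈ dsupp a := by rw [ha]; rfl
    exact this
  rw [ha'] at hmem
  exact hmem.symm

/-! ### The cuspidal / non-cuspidal structure and the prime data -/

/-- A prime of `Φ(A_⊚)` is CUSPIDAL iff its index is a cusp `inr n`. [cite: MochizukiEtTh2009, Prop 5.3 p.325 (PDF p.99)] -/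
def IsCuspZ (𝔭 : Primes Φz) : Prop := ∃ n : ℤ, idxZ 𝔭 = Sum.inr n

/-- `PZ (inr n)` is cuspidal. [cite: MochizukiEtTh2009, Prop 5.3 p.325 (PDF p.99)] -/
theorem isCuspZ_PZ_inr (n : ℤ) : IsCuspZ (PZ (Sum.inr n)) := ⟨n, idxZ_PZ _⟩

/-- `PZ (inl n)` is not cuspidal. [cite: MochizukiEtTh2009, Prop 5.3 p.325 (PDF p.99)] -/
theorem not_isCuspZ_PZ_inl (n : ℤ) : ¬ IsCuspZ (PZ (Sum.inl n)) := by
  rintro ⟨m, hm⟩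
  rw [idxZ_PZ] at hm
  exact Sum.inl_ne_inr hm

/-- A non-cuspidal prime has index `inl n`. [cite: MochizukiEtTh2009, Prop 5.3 p.325 (PDF p.99)] -/
theorem idxZ_eq_inl_of_not_isCuspZ {𝔭 : Primes Φz} (h : ¬ IsCuspZ 𝔭) : ∃ n, idxZ 𝔭 = Sum.inl n := by
  rcases hi : idxZ 𝔭 with n | n
  · exact ⟨n, rfl⟩
  · exact (h ⟨n, hi⟩).elim

/-- The label of a prime: `inl n ↦ n`, `inr n ↦ n`. [cite: MochizukiEtTh2009, Prop 5.3 (v) p.325 (PDF p.99)] -/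
def labelZ (𝔭 : Primes Φz) : ℤ := Sum.elim id id (idxZ 𝔭)

/-- `labelZ (PZ (inl n)) = n`. [cite: MochizukiEtTh2009, Prop 5.3 (v) p.325 (PDF p.99)] -/
@[simp] theorem labelZ_PZ_inl (n : ℤ) : labelZ (PZ (Sum.inl n)) = n := by simp [labelZ]
/-- `labelZ (PZ (inr n)) = n`. [cite: MochizukiEtTh2009, Prop 5.3 (v) p.325 (PDF p.99)] -/
@[simp] theorem labelZ_PZ_inr (n : ℤ) : labelZ (PZ (Sum.inr n)) = n := by simp [labelZ]

/-- A non-cuspidal prime is `PZ (inl (labelZ 𝔭))`. [cite: MochizukiEtTh2009, Prop 5.3 (v) p.325 (PDF p.99)] -/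
theorem PZ_inl_labelZ {𝔭 : Primes Φz} (h : ¬ IsCuspZ 𝔭) : PZ (Sum.inl (labelZ 𝔭)) = 𝔭 := by
  obtain ⟨n, hn⟩ := idxZ_eq_inl_of_not_isCuspZ h
  have : labelZ 𝔭 = n := by simp [labelZ, hn]
  rw [this, ← hn, PZ_idxZ]

/-- A cuspidal prime is `PZ (inr (labelZ 𝔭))`. [cite: MochizukiEtTh2009, Prop 5.3 p.325 (PDF p.99)] -/
theorem PZ_inr_labelZ {𝔭 : Primes Φz} (h : IsCuspZ 𝔭) : PZ (Sum.inr (labelZ 𝔭)) = 𝔭 := by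
  obtain ⟨n, hn⟩ := h
  have : labelZ 𝔭 = n := by simp [labelZ, hn]
  rw [this, ← hn, PZ_idxZ]

/-- The canonical isomorphism between two primary components (both `≅ ℤ_{≥0}` by evaluation at their index).
[cite: MochizukiEtTh2009, Prop 5.3 (ii) p.325 (PDF p.99)] -/
def canonIsoZ (𝔭 𝔮 : Primes Φz) : ↥𝔭.submonoid ≃* ↥𝔮.submonoid :=
  (PiMonoprime.submonoidEquiv hPz 𝔭 (idxZ 𝔭) (PZ_idxZ 𝔭)).trans (PiMonoprime.submonoidEquiv hPz 𝔮 (idxZ 𝔮) (PZ_idxZ 𝔮)).symm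

/-- `𝟙_cusps ∈ Φ(A_⊚)`: `1` at every cusp, `0` at every component (the divisor of zeroes of `Θ̈`, Prop. 1.4 (i): simple zeros
at the cusps) — INFINITELY supported. [cite: MochizukiEtTh2009, Prop 1.4 (i) p.247 (PDF p.21)] -/
def cuspOne : Φz := fun i => Sum.elim (fun _ => (1 : Multiplicative ℕ)) (fun _ => Multiplicative.ofAdd 1) i

/-- `𝟙_cusps` at a component. [cite: MochizukiEtTh2009, Prop 1.4 (i) p.247 (PDF p.21)] -/
@[simp] theorem cuspOne_inl (n : ℤ) : cuspOne (Sum.inl n) = 1 := rfl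
/-- `𝟙_cusps` at a cusp. [cite: MochizukiEtTh2009, Prop 1.4 (i) p.247 (PDF p.21)] -/
@[simp] theorem cuspOne_inr (n : ℤ) : cuspOne (Sum.inr n) = Multiplicative.ofAdd 1 := rfl

/-- **The prime data of the `ℤ`-chain model**: cuspidal primes = `inr`-indexed; cuspidal (resp. non-cuspidal) ELEMENTS = those
lying in the subset of a cuspidal (resp. non-cuspidal) prime; canonical component isomorphisms; `Prime^csp ↠ Prime^ncsp :
x_n ↦ C_n` (the component carrying the cusp); labels `C_n ↦ n`; **`div(Θ̈) := [𝟙_cusps]`**.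
[cite: MochizukiEtTh2009, Prop 5.3 p.325 (PDF p.99)] -/
def chainPrimeDataZ : DivisorPrimeData chainThetaZ where
  IsCuspidalElt a := ∀ 𝔭 : Primes Φz, a ∈ 𝔭.carrier → IsCuspZ 𝔭
  IsNonCuspidalElt a := ∀ 𝔭 : Primes Φz, a ∈ 𝔭.carrier → ¬ IsCuspZ 𝔭
  IsCuspidal := IsCuspZ
  isCuspidal_iff 𝔭 := by
    constructor
    · intro h a ha 𝔮 hq
      rwa [← primes_eq_of_mem_carrier ha hq]
    · intro h
      obtain ⟨a, ha⟩ := exists_mem_carrier 𝔭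
      exact h a ha 𝔭 ha
  ncspIso 𝔭 𝔮 _ _ := canonIsoZ 𝔭 𝔮
  cspIso 𝔭 𝔮 _ _ := canonIsoZ 𝔭 𝔮
  cspToNcsp 𝔭 := ⟨PZ (Sum.inl (labelZ 𝔭.1)), not_isCuspZ_PZ_inl _⟩
  cspToNcsp_surjective := by
    rintro ⟨𝔮, hq⟩
    obtain ⟨n, hn⟩ := idxZ_eq_inl_of_not_isCuspZ hq
    refine ⟨⟨PZ (Sum.inr n), isCuspZ_PZ_inr n⟩, Subtype.ext ?_⟩
    change PZ (Sum.inl (labelZ (PZ (Sum.inr n)))) = 𝔮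
    rw [labelZ_PZ_inr, ← hn, PZ_idxZ]
  ncspEquivZ :=
    { toFun := fun 𝔭 => labelZ 𝔭.1
      invFun := fun n => ⟨PZ (Sum.inl n), not_isCuspZ_PZ_inl n⟩
      left_inv := fun 𝔭 => Subtype.ext (PZ_inl_labelZ 𝔭.2)
      right_inv := fun n => labelZ_PZ_inl n }
  divTheta := Algebra.GrothendieckGroup.of cuspOne

/-- `IsCuspidal` of the prime data is `IsCuspZ`. [cite: MochizukiEtTh2009, Prop 5.3 p.325 (PDF p.99)] -/
theorem isCuspidal_iff' (𝔭 : Primes Φz) : chainPrimeDataZ.IsCuspidal 𝔭 ↔ IsCuspZ 𝔭 := Iff.rfl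

/-- The label of a non-cuspidal prime under `ncspEquivZ`. [cite: MochizukiEtTh2009, Prop 5.3 (v) p.325 (PDF p.99)] -/
@[simp] theorem ncspEquivZ_apply (𝔭 : {p : Primes Φz // ¬ chainPrimeDataZ.IsCuspidal p}) :
    chainPrimeDataZ.ncspEquivZ 𝔭 = labelZ 𝔭.1 := rfl

/-- `cspToNcsp` sends a cuspidal prime to the component with the same label. [cite: MochizukiEtTh2009, Prop 5.3 (iv) p.325 (PDF p.99)] -/
theorem cspToNcsp_val (𝔭 : {p : Primes Φz // chainPrimeDataZ.IsCuspidal p}) :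
    (chainPrimeDataZ.cspToNcsp 𝔭).1 = PZ (Sum.inl (labelZ 𝔭.1)) := rfl

/-- Every translation of the chain is realised by an automorphism of `A_⊚` (f-128's `exists_aut_translate`), and it re-indexes
the primes by the translation: cusps to cusps, labels shifted. [cite: MochizukiEtTh2009, §1 p.238 (PDF p.12)] -/
theorem idxZ_congr_pullAut (g : Aut chainThetaZ.Acirc) (𝔭 : Primes Φz) :
    idxZ (Primes.congr (chainThetaZ.pullAut g) 𝔭) = shift (Multiplicative.toAdd g.inv) (idxZ 𝔭) :=
  idxZ_congr_reindexZ _ 𝔭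

end Literature.AnabelianGeometry.EtaleTheta.FrobenioidThetaDivisors.Prop53ChainZ

end
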